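import Mathlib
import HarnessLib
import Summits.HubbardSuperconductivity.HubbardSuperconductivity.Theorems.KLProgrammeKLRegimeTwoVolumeGridBlockStep
import Summits.HubbardSuperconductivity.HubbardSuperconductivity.Theorems.KLProgrammeKLRegimeTwoVolumeBlockDefectGramBounded
import Literature.MathematicalPhysics.QuantumLattice.GrassmannGramBoundedWeights
import Literature.MathematicalPhysics.QuantumLattice.GrassmannGramBoundedSum

/-!
# Route `KLProgramme` — crux K3, the nested two-volume pass (β′) ON THE MODEL with Gram PROPERTIES only: the model step
# `hubbardGrid_sum_norm_kernel_sub_le` with the charged Gram FORMS of the two grid covariances replaced by `IsGramBoundedR C_L κ`, `IsGramBoundedR C_{Lf} κ′`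
# (cell gate-hubbard-kl, seat hubbard-kl-k3c4-p1 g7)

`…TwoVolumeGridBlockStep.hubbardGrid_sum_norm_kernel_sub_le` (p524747) asks for charged Gram FORMS of both covariances (the (m3) export of the UV lane, which
has none yet).  The form-free door `…TwoVolumeBlockDefectGramBounded.sum_norm_kernel_sub_copies_le_of_gramBounded` (p526393) asks only for replica-Gram-
boundedness of the two DEFECTS; the property-level Gram algebra now in the tree supplies it from the two covariances: the decoupled copies of `C_L` are
Gram-bounded with `κ` (`isGramBoundedR_blockCopies`), `C_{Lf} − C^{cop}` with `κ′ + κ` (`IsGramBoundedR.sub`, doubling trick, `GrassmannGramBoundedSum`), the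
far defect `1_{Z×Z}(C_{Lf} − C^{cop})` and its Duhamel scalings with `κ′ + κ` (`isGramBoundedR_mask`, `isGramBoundedR_real_smul`), the near defect
`(C_{Lf} − C^{cop}) − D_far` with `2(κ′ + κ)`.  Everything else (block structure, zone, (P), (G1)/(G2), gluing, the `e`-free reading) is verbatim the model step.

* **`hubbardGrid_sum_norm_kernel_sub_le_of_gramBoundedR`** — THE MODEL STEP FROM ONE-VOLUME DATA AND GRAM PROPERTIES: as `hubbardGrid_sum_norm_kernel_sub_le` with
  `(hGB : IsGramBoundedR C_L κ) (hGB′ : IsGramBoundedR C_{Lf} κ′)` (`0 < κ`, `0 ≤ κ′`) in place of the forms, `κ_f := κ′ + κ`, `κ_n := 2(κ′ + κ)` in the bound.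
  The Gram properties of the grid covariances are theorems of the tree (`isGramBoundedR_gridSub_twoCutoff`, `isGramBoundedR_scaleZero_of_frameOK_sharp`, …).

Sorry-free; no definition.  References: BGM 2006 §2–§3 ((2.13)–(2.14), (2.77)–(2.80)); Salmhofer 1999 (2.102)–(2.106), §4.2.4; Pedra–Salmhofer 2008 Thm 1.3.
-/

noncomputable section

namespace Summit.HubbardSuperconductivity.HubbardSuperconductivity.Theorems.TwoVolumeDefect

set_option linter.dupNamespace false -- summit = problem name (single-conjunct summit), D-0017

open Finset Literature.MathematicalPhysics.QuantumLattice GrassmannAlgebra Literature.Probability.LatticeModels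
  Literature.Probability.LatticeModels.BattleFederbush Summit.HubbardSuperconductivity.HubbardSuperconductivity.Theorems.TwoPointAssembly
open scoped Nat

/-- **THE NESTED TWO-VOLUME STEP ON THE MODEL, FROM ONE-VOLUME DATA AND GRAM PROPERTIES.**  As `hubbardGrid_sum_norm_kernel_sub_le`, with the charged Gram
forms replaced by `IsGramBoundedR C_L κ`, `IsGramBoundedR C_{Lf} κ′`; far constant `κ′ + κ`, near constant `2(κ′ + κ)`.
[folklore; BGM 2006 §2–§3; Salmhofer 1999 (2.102)–(2.106); Pedra–Salmhofer 2008 Thm 1.3] -/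
theorem hubbardGrid_sum_norm_kernel_sub_le_of_gramBoundedR {b L Lf M N : ℕ} [NeZero Lf] [NeZero L] [LinearOrder (GridLeg (GridPoint Lf N))]
    (hLf : Lf = b * L) {β : ℝ} (hβ : β ≠ 0)
    (F : MatsubaraIdx M → Fin 2 → (Fin 2 → ℝ) → ℂ) (pL : FreqMomentum L M × Fin 2 → ℂ) (pLf : FreqMomentum Lf M × Fin 2 → ℂ)
    (hpL : ∀ (k : FreqMomentum L M) (σ : Fin 2), pL (k, σ) = ((β * (L : ℝ) ^ 2 : ℝ) : ℂ) * F k.1 σ (latticeMomentum L k.2))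
    (hpLf : ∀ (k : FreqMomentum Lf M) (σ : Fin 2), pLf (k, σ) = ((β * (Lf : ℝ) ^ 2 : ℝ) : ℂ) * F k.1 σ (latticeMomentum Lf k.2))
    (CL : Matrix (GridLeg (GridPoint L N)) (GridLeg (GridPoint L N)) ℂ)
    (hCL : CL = (hubbardGridSub L M β N).transpose * normalCovariance L M pL * hubbardGridSub L M β N)
    (CLf : Matrix (GridLeg (GridPoint Lf N)) (GridLeg (GridPoint Lf N)) ℂ)
    (hCLf : CLf = (hubbardGridSub Lf M β N).transpose * normalCovariance Lf M pLf * hubbardGridSub Lf M β N)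
    -- depth of the zone, extra depth of the pin, the pin
    (R R' : ℕ) (w : GridLeg (GridPoint Lf N)) (hw : ∀ j, R + R' ≤ (w.1.1.2 j).val % L ∧ (w.1.1.2 j).val % L + (R + R') < L)
    -- decay numbers of the two covariances
    {T : ℝ} (hT0 : 0 < T) (hT : ∀ X', ∑ Y' ∈ univ.filter (fun Y' : GridLeg (GridPoint Lf N) => R < Torus.tnorm (X'.1.1.2 - Y'.1.1.2)), ‖CLf X' Y'‖ ≤ T)
    {s s' : ℝ} (hs0 : 0 ≤ s) (hs'0 : 0 ≤ s') (hs : ∀ X Y, ‖CL X Y‖ ≤ s) (hs' : ∀ X' Y', ‖CLf X' Y'‖ ≤ s')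
    {α α' : ℝ} (hαα : 0 < α' + α) (hrow : ∀ X, ∑ Y, ‖CL X Y‖ ≤ α) (hrow' : ∀ X', ∑ Y', ‖CLf X' Y'‖ ≤ α')
    {m₁ m₁' : ℝ} (hm0 : 0 ≤ m₁) (hm0' : 0 ≤ m₁')
    (hm1 : ∀ X, ∑ Y, ‖CL X Y‖ * (Torus.tnorm (X.1.1.2 - Y.1.1.2) : ℝ) ≤ m₁)
    (hm1' : ∀ X', ∑ Y', ‖CLf X' Y'‖ *
      (Torus.tnorm ((fun i => (((X'.1.1.2 i).val : ℕ) : ZMod L)) - fun i => (((Y'.1.1.2 i).val : ℕ) : ZMod L)) : ℝ) ≤ m₁')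
    -- replica-Gram-boundedness of the two covariances (PROPERTIES; no Gram vectors)
    {κ κ' : ℝ} (hκ : 0 < κ) (hκ' : 0 ≤ κ') (hGB : IsGramBoundedR CL κ) (hGB' : IsGramBoundedR CLf κ')
    -- the interactions
    (U : ℝ) (ν : ℂ) (hZ : IsUnit (effPartitionFn ℂ CL (hubbardGridInteraction L N β U + ν • hubbardGridQuadratic L N β)))
    -- the coarse weighted profile and the smallness conditions
    (Nw : ℕ → ℝ) (hNw0 : ∀ m, 0 ≤ Nw m)
    (hNw : ∀ (m' : ℕ) (j : Fin (2 * m')) (x : GridLeg (GridPoint L N)),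
      ∑ Y ∈ univ.filter (fun Y : Fin (2 * m') → GridLeg (GridPoint L N) => Y j = x),
        ‖kernel ℂ (effAction ℂ CL (hubbardGridInteraction L N β U + ν • hubbardGridQuadratic L N β)) (2 * m') Y‖ *
          (1 + labelDiam (fun Y₁ Y₂ : GridLeg (GridPoint L N) => (Torus.tnorm (Y₁.1.1.2 - Y₂.1.1.2) : ℝ)) (univ.image Y)) ≤ Nw m')
    {ρf : ℝ} (hρf : 0 < ρf)
    (hθw : Real.exp 1 * (α' + α + (m₁' + m₁)) * normV (GridLeg (GridPoint Lf N)) (κ' + κ) ρf Nw / (κ' + κ) ^ 2 < 1)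
    {ρn : ℝ} (hρn : 0 < ρn)
    (hθn : Real.exp 1 * (2 * T) * normV (GridLeg (GridPoint Lf N)) ((κ' + κ + (κ' + κ))) ρn
        (fun m' => ρf⁻¹ ^ (2 * m') * (Real.exp 1 * normV (GridLeg (GridPoint Lf N)) (κ' + κ) ρf Nw) /
          (1 - Real.exp 1 * (α' + α + (m₁' + m₁)) * normV (GridLeg (GridPoint Lf N)) (κ' + κ) ρf Nw / (κ' + κ) ^ 2)) /
        (κ' + κ + (κ' + κ)) ^ 2 < 1)
    {k : ℕ} (hk : ∀ D : Matrix (GridLeg (GridPoint Lf N)) (GridLeg (GridPoint Lf N)) ℂ, grassmannLaplacian ℂ D ^ k = 0)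
    (n : ℕ) (p : Fin (n + 1)) :
    ∑ X ∈ univ.filter (fun X : Fin (n + 1) → GridLeg (GridPoint Lf N) => X p = w),
        ‖kernel ℂ (effAction ℂ CLf (hubbardGridInteraction Lf N β U + ν • hubbardGridQuadratic Lf N β)) (n + 1) X -
          (if ∀ i j, ((X i).1.1.2 j).val / L = ((X p).1.1.2 j).val / L then
            kernel ℂ (effAction ℂ CL (hubbardGridInteraction L N β U + ν • hubbardGridQuadratic L N β)) (n + 1)
              (fun i => ((((X i).1.1.1, fun j => ((((X i).1.1.2 j).val : ℕ) : ZMod L)), (X i).1.2), (X i).2))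
          else 0)‖ ≤
      (∑ j ∈ Ico 1 k, ((n + 1 + 2 * j)! : ℝ) / (((n + 1) ! : ℝ) * (j ! : ℝ) * 2 ^ j) * T ^ j *
            (ρf⁻¹ ^ (n + 1 + 2 * j) * (Real.exp 1 * normV (GridLeg (GridPoint Lf N)) (κ' + κ) ρf Nw) /
              (1 - Real.exp 1 * (α' + α + (m₁' + m₁)) * normV (GridLeg (GridPoint Lf N)) (κ' + κ) ρf Nw / (κ' + κ) ^ 2)) +
          ρn⁻¹ ^ (n + 1) * (Real.exp 1 * normV (GridLeg (GridPoint Lf N)) ((κ' + κ + (κ' + κ))) ρn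
            (fun m' => ρf⁻¹ ^ (2 * m') * (Real.exp 1 * normV (GridLeg (GridPoint Lf N)) (κ' + κ) ρf Nw) /
              (1 - Real.exp 1 * (α' + α + (m₁' + m₁)) * normV (GridLeg (GridPoint Lf N)) (κ' + κ) ρf Nw / (κ' + κ) ^ 2))) *
            (Real.exp 1 * (2 * T) * normV (GridLeg (GridPoint Lf N)) ((κ' + κ + (κ' + κ))) ρn
                (fun m' => ρf⁻¹ ^ (2 * m') * (Real.exp 1 * normV (GridLeg (GridPoint Lf N)) (κ' + κ) ρf Nw) /
                  (1 - Real.exp 1 * (α' + α + (m₁' + m₁)) * normV (GridLeg (GridPoint Lf N)) (κ' + κ) ρf Nw / (κ' + κ) ^ 2)) /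
                (κ' + κ + (κ' + κ)) ^ 2) /
              (1 - Real.exp 1 * (2 * T) * normV (GridLeg (GridPoint Lf N)) ((κ' + κ + (κ' + κ))) ρn
                (fun m' => ρf⁻¹ ^ (2 * m') * (Real.exp 1 * normV (GridLeg (GridPoint Lf N)) (κ' + κ) ρf Nw) /
                  (1 - Real.exp 1 * (α' + α + (m₁' + m₁)) * normV (GridLeg (GridPoint Lf N)) (κ' + κ) ρf Nw / (κ' + κ) ^ 2)) /
                (κ' + κ + (κ' + κ)) ^ 2)) +
        ((((n + 1 + 1) * (n + 1 + 2) : ℕ) : ℝ) / 2 * ((s' + s) / ((R' : ℝ) + 1)) *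
            (ρf⁻¹ ^ (n + 3) * (Real.exp 1 * normV (GridLeg (GridPoint Lf N)) (κ' + κ) ρf Nw) /
              (1 - Real.exp 1 * (α' + α + (m₁' + m₁)) * normV (GridLeg (GridPoint Lf N)) (κ' + κ) ρf Nw / (κ' + κ) ^ 2)) +
          ‖(2 : ℂ)⁻¹‖ * ∑ a ∈ range (n + 2), ∑ b' ∈ range (n + 2),
            (if a + b' = n + 1 then (((a + 1) * (b' + 1) : ℕ) : ℝ) *
              ((α' + α) *
                  (ρf⁻¹ ^ (a + 1) * (Real.exp 1 * normV (GridLeg (GridPoint Lf N)) (κ' + κ) ρf Nw) /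
                      (1 - Real.exp 1 * (α' + α + (m₁' + m₁)) * normV (GridLeg (GridPoint Lf N)) (κ' + κ) ρf Nw / (κ' + κ) ^ 2) / ((R' : ℝ) + 1)) *
                  (ρf⁻¹ ^ (b' + 1) * (Real.exp 1 * normV (GridLeg (GridPoint Lf N)) (κ' + κ) ρf Nw) /
                    (1 - Real.exp 1 * (α' + α + (m₁' + m₁)) * normV (GridLeg (GridPoint Lf N)) (κ' + κ) ρf Nw / (κ' + κ) ^ 2)) +
                (α' + α) *
                  (ρf⁻¹ ^ (a + 1) * (Real.exp 1 * normV (GridLeg (GridPoint Lf N)) (κ' + κ) ρf Nw) /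
                    (1 - Real.exp 1 * (α' + α + (m₁' + m₁)) * normV (GridLeg (GridPoint Lf N)) (κ' + κ) ρf Nw / (κ' + κ) ^ 2)) *
                  (ρf⁻¹ ^ (b' + 1) * (Real.exp 1 * normV (GridLeg (GridPoint Lf N)) (κ' + κ) ρf Nw) /
                      (1 - Real.exp 1 * (α' + α + (m₁' + m₁)) * normV (GridLeg (GridPoint Lf N)) (κ' + κ) ρf Nw / (κ' + κ) ^ 2) / ((R' : ℝ) + 1))) else 0)) := by
  -- the block structure of the grid legs
  obtain ⟨e, he1, he2⟩ := exists_gridLegBlockEquiv hLf N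
  -- a block embedding per box
  set Fe : (Fin 2 → Fin b) → (GridLeg (GridPoint L N) → ℂ) →ₗ[ℂ] (GridLeg (GridPoint Lf N) → ℂ) := fun β' =>
    LinearMap.pi (fun X' : GridLeg (GridPoint Lf N) => if (e X').1 = β' then
      (LinearMap.proj (e X').2 : (GridLeg (GridPoint L N) → ℂ) →ₗ[ℂ] ℂ) else 0) with hFe_def
  have hFe : ∀ β' v X', Fe β' v X' = if (e X').1 = β' then v (e X').2 else 0 := fun β' v X' => blockEmb_pi_apply ℂ e β' v X'
  -- the pieces
  set Ccop : Matrix (GridLeg (GridPoint Lf N)) (GridLeg (GridPoint Lf N)) ℂ :=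
    Matrix.of fun X' Y' => if (e X').1 = (e Y').1 then CL (e X').2 (e Y').2 else 0 with hCcop_def
  set Zs : Set (GridLeg (GridPoint Lf N)) := {X' | ¬ ∀ j, R ≤ (X'.1.1.2 j).val % L ∧ (X'.1.1.2 j).val % L + R < L} with hZs_def
  set Df : Matrix (GridLeg (GridPoint Lf N)) (GridLeg (GridPoint Lf N)) ℂ :=
    Matrix.of fun X' Y' => if X' ∈ Zs ∧ Y' ∈ Zs then CLf X' Y' - Ccop X' Y' else 0 with hDf_def
  set Dn : Matrix (GridLeg (GridPoint Lf N)) (GridLeg (GridPoint Lf N)) ℂ :=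
    Matrix.of fun X' Y' => if X' ∈ Zs ∧ Y' ∈ Zs then 0 else CLf X' Y' - Ccop X' Y' with hDn_def
  have hCcop : ∀ X' Y', Ccop X' Y' = if (e X').1 = (e Y').1 then CL (e X').2 (e Y').2 else 0 := fun X' Y' => rfl
  have hDf : ∀ X' Y', Df X' Y' = if X' ∈ Zs ∧ Y' ∈ Zs then CLf X' Y' - Ccop X' Y' else 0 := fun X' Y' => rfl
  have hDn : ∀ X' Y', Dn X' Y' = if X' ∈ Zs ∧ Y' ∈ Zs then 0 else CLf X' Y' - Ccop X' Y' := fun X' Y' => rfl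
  -- (P) periodisation, antisymmetry, charge selection of the grid pull-backs
  have hP : ∀ (X' : GridLeg (GridPoint Lf N)) (Y : GridLeg (GridPoint L N)),
      ∑ Y'' ∈ univ.filter (fun Y'' : GridLeg (GridPoint Lf N) => (e Y'').2 = Y), CLf X' Y'' = CL (e X').2 Y := by
    intro X' Y
    rw [hCL, hCLf]
    exact hubbardGridSub_pullback_periodise_leg hLf hβ N F pL pLf hpL hpLf e he2 X' Y
  have hCt : ∀ X Y, CL Y X = -CL X Y := fun X Y => by rw [hCL]; exact hubbardGridSub_pullback_swap β N pL X Y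
  have hC't : ∀ X' Y', CLf Y' X' = -CLf X' Y' := fun X' Y' => by rw [hCLf]; exact hubbardGridSub_pullback_swap β N pLf X' Y'
  -- the glued interaction is the fine one
  have hglue : ∑ β', ExteriorAlgebra.map (Fe β') (hubbardGridInteraction L N β U + ν • hubbardGridQuadratic L N β) =
      hubbardGridInteraction Lf N β U + ν • hubbardGridQuadratic Lf N β := by
    simp only [map_add, map_smul, sum_add_distrib, ← Finset.smul_sum]
    rw [sum_map_blockEmb_hubbardGridInteraction e he1 he2 Fe hFe, sum_map_blockEmb_hubbardGridQuadratic e he1 he2 Fe hFe]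
  have hglue' : ∑ β', ExteriorAlgebra.map (Fe β') (effAction ℂ CL (hubbardGridInteraction L N β U + ν • hubbardGridQuadratic L N β)) =
      effAction ℂ Ccop (hubbardGridInteraction Lf N β U + ν • hubbardGridQuadratic Lf N β) := by
    rw [← hglue]
    exact ((effAction_copies_sum e CL Ccop hCcop Fe hFe
      ((mem_evenPart_iff).1 (add_mem (hubbardGridInteraction_mem_evenPart β U)
        (Subalgebra.smul_mem _ (hubbardGridQuadratic_mem_evenPart β) ν)))
      (by rw [map_add, map_smul, constPart_hubbardGridInteraction, constPart_hubbardGridQuadratic, smul_zero, add_zero]) hZ univ).2).symm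
  -- the e-free reading of the subtracted kernel
  have hsub : ∀ X : Fin (n + 1) → GridLeg (GridPoint Lf N),
      kernel ℂ (∑ β', ExteriorAlgebra.map (Fe β') (effAction ℂ CL (hubbardGridInteraction L N β U + ν • hubbardGridQuadratic L N β))) (n + 1) X =
        if ∀ i j, ((X i).1.1.2 j).val / L = ((X p).1.1.2 j).val / L then
          kernel ℂ (effAction ℂ CL (hubbardGridInteraction L N β U + ν • hubbardGridQuadratic L N β)) (n + 1)
            (fun i => ((((X i).1.1.1, fun j => ((((X i).1.1.2 j).val : ℕ) : ZMod L)), (X i).1.2), (X i).2))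
        else 0 := by
    intro X
    rw [kernel_copies_sum e Fe hFe _ p X]
    have hiff : (∀ i, (e (X i)).1 = (e (X p)).1) ↔ ∀ i j, ((X i).1.1.2 j).val / L = ((X p).1.1.2 j).val / L := by
      refine ⟨fun h i j => ?_, fun h i => funext fun j => Fin.ext ?_⟩
      · rw [← he1, ← he1, h i]
      · rw [he1, he1]; exact h i j
    have hproj : (fun i => (e (X i)).2) = fun i => ((((X i).1.1.1, fun j => ((((X i).1.1.2 j).val : ℕ) : ZMod L)), (X i).1.2), (X i).2) :=
      funext fun i => he2 (X i)
    by_cases h : ∀ i j, ((X i).1.1.2 j).val / L = ((X p).1.1.2 j).val / L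
    · rw [if_pos (hiff.2 h), if_pos h, hproj]
    · rw [if_neg (fun h' => h (hiff.1 h')), if_neg h]
  simp_rw [← hsub, ← hglue]
  -- geometry: (G1), (G2), the pin is far from the zone in the coarse distance
  have hG1 : ∀ X' Y', (e X').1 ≠ (e Y').1 → ¬ (X' ∈ Zs ∧ Y' ∈ Zs) → R < Torus.tnorm (X'.1.1.2 - Y'.1.1.2) :=
    fun X' Y' hne hnz => far_of_block_ne hLf e he1 hne hnz
  have hG2 : ∀ X' Y' Y'', (e X').1 = (e Y').1 → (e Y'').2 = (e Y').2 → Y'' ≠ Y' → ¬ (X' ∈ Zs ∧ Y' ∈ Zs) →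
      R < Torus.tnorm (X'.1.1.2 - Y''.1.1.2) :=
    fun X' Y' Y'' hb hf hn hnz => far_of_fibre_ne hLf e he1 he2 hb hf hn hnz
  have hdR : ∀ X, X ∈ Zs → (R' : ℝ) + 1 ≤
      (fun Y₁ Y₂ : GridLeg (GridPoint L N) => (Torus.tnorm (Y₁.1.1.2 - Y₂.1.1.2) : ℝ)) (e X).2 (e w).2 := by
    intro X hX
    have h := tnorm_red_sub_gt_of_not_deep_of_deep (L := L) hX hw
    dsimp only
    rw [he2, he2]
    exact_mod_cast Nat.succ_le_of_lt h
  -- the first moment of the fine covariance in the pulled-back coarse distance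
  have hm1'' : ∀ X', ∑ Y', ‖CLf X' Y'‖ *
      (fun Y₁ Y₂ : GridLeg (GridPoint L N) => (Torus.tnorm (Y₁.1.1.2 - Y₂.1.1.2) : ℝ)) (e X').2 (e Y').2 ≤ m₁' := by
    intro X'
    refine le_trans (le_of_eq (sum_congr rfl fun Y' _ => ?_)) (hm1' X')
    dsimp only
    rw [he2, he2]
  -- parity / constant part of the coarse interaction
  have hVe : hubbardGridInteraction L N β U + ν • hubbardGridQuadratic L N β ∈ evenOdd ℂ 0 :=
    (mem_evenPart_iff).1 (add_mem (hubbardGridInteraction_mem_evenPart β U) (Subalgebra.smul_mem _ (hubbardGridQuadratic_mem_evenPart β) ν))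
  have hV0 : constPart ℂ (hubbardGridInteraction L N β U + ν • hubbardGridQuadratic L N β) = 0 := by
    rw [map_add, map_smul, constPart_hubbardGridInteraction, constPart_hubbardGridQuadratic, smul_zero, add_zero]
  -- the Gram PROPERTIES of the two defects from those of `C_L`, `C_{Lf}` (copies, difference, mask, Duhamel scaling)
  have hGBcop : IsGramBoundedR Ccop κ := isGramBoundedR_blockCopies hGB (fun X' => (e X').1) (fun X' => (e X').2) Ccop hCcop
  have hGBsub : IsGramBoundedR (CLf - Ccop) (κ' + κ) := hGB'.sub hGBcop hκ'
  have hGBf1 : IsGramBoundedR Df (κ' + κ) :=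
    isGramBoundedR_mask hGBsub Zs Df (fun X' Y' => by rw [hDf, Matrix.sub_apply])
  have hGBf : ∀ t ∈ Set.Icc (0 : ℝ) 1, IsGramBoundedR (t • Df) (κ' + κ) := fun t ht => isGramBoundedR_real_smul hGBf1 ht.1 ht.2
  have hDn_eq : Dn = (CLf - Ccop) - Df := by
    ext X' Y'
    rw [hDn, Matrix.sub_apply, Matrix.sub_apply, hDf]
    split_ifs <;> simp
  have hGBn : IsGramBoundedR Dn (κ' + κ + (κ' + κ)) := by
    rw [hDn_eq]; exact hGBsub.sub hGBf1 (add_nonneg hκ' hκ.le)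
  have hmain := sum_norm_kernel_sub_copies_le_of_gramBounded e CL CLf Ccop Dn Df Zs hCcop hDf hDn hP
    (fun X' Y' => R < Torus.tnorm (X'.1.1.2 - Y'.1.1.2)) hG1 hG2 hT0 hT hCt hC't hs0 hs'0 hs hs' hαα hrow hrow'
    (fun Y₁ Y₂ : GridLeg (GridPoint L N) => (Torus.tnorm (Y₁.1.1.2 - Y₂.1.1.2) : ℝ)) isLabelDist_tnorm_site hm0 hm0' hm1 hm1''
    (add_pos_of_nonneg_of_pos hκ' hκ) hGBf (add_pos (add_pos_of_nonneg_of_pos hκ' hκ) (add_pos_of_nonneg_of_pos hκ' hκ)) hGBn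
    (by positivity) w hdR Fe hFe hVe hV0 hZ Nw hNw0 hNw hρf hθw hρn hθn (hk Dn) n p
  convert hmain using 3

end Summit.HubbardSuperconductivity.HubbardSuperconductivity.Theorems.TwoVolumeDefect

end
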